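import Literature.Barriers.CriticalPhenomena.LongRangeTrivialityOnZ3TorusZeroMode
import Literature.Barriers.CriticalPhenomena.LongRangeTrivialityOnZ3InfraredBound
import Literature.Barriers.CriticalPhenomena.LongRangeTrivialityOnZ3MMSWalk
import Literature.Probability.LatticeModels.WeightedInfraredBound
import Mathlib.Analysis.SpecialFunctions.Gamma.Basic

/-!
# Reflection positivity of the periodised power-law coupling on the even torus, and the torus
# infrared bound for `J_{x,y} = C₀|x-y|₁^{-d-α}` (Panis 2023, §3.1 example (iii) and Proposition 3.4)

Sibling of `Literature/Barriers/CriticalPhenomena/LongRangeTrivialityOnZ3.lean` (barrier catalogue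
D-0021, sub-problem `Ising3DConformalLimit`), part of the TORUS ROUTE to the named fact
`Literature.Barriers.CriticalPhenomena.panis_infraredBound_algebraic` (Panis, arXiv:2309.05797 =
Ann. Probab. 54 (2026), §3.6 / Proposition 3.8) — completed in the sequel
`LongRangeTrivialityOnZ3InfraredBoundHolds.lean`, which DISCHARGES that fact. Here the analytic input of
Panis's Proposition 3.4 (the torus infrared bound, from the Gaussian domination of Fröhlich–Israel–Lieb–Simon
for reflection-positive pair interactions, proved in the tree as
`Literature.Probability.LatticeModels.wInfraredBound`) is supplied for the algebraically decaying
coupling: its periodisation `J^{(N)}_{0,w} = ∑_{z∈ℤ^d}J_{0,w̃+Nz}` (`torusCoupling`) is REFLECTION POSITIVE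
through the bond mirrors of the even torus, in the form `wInfraredBound` consumes (invariance and
positive semidefinite crossing kernels). Everything is PROVED:

1. `pexp N t r = (e^{-tr}+e^{-t(N-r)})/(1-e^{-tN}) = ∑_{n∈ℤ}e^{-t|r+Nn|}` (`hasSum_exp_neg_mul_abs_periodic`),
   and its FEATURE FACTORISATION on `ℤ/Nℤ` (`sum_exp_val_sub_mul_exp_val_sub`):
   `∑_{m}e^{-t·val(a-m)}e^{-t·val(b-m)} = (1-e^{-tN})/(1-e^{-2t})·(e^{-tr}+e^{-t(N-r)})`, `r = val(a-b)` —
   the translation-invariant periodised exponential kernel is a positive combination of rank-one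
   kernels, hence positive semidefinite (no Fourier analysis needed);
2. the LAPLACE REPRESENTATION `J^{(N)}_{0,w} = (C₀/Γ(s))∫₀^∞t^{s-1}∏ᵢ pexp N t (w̃ᵢ) dt`, `s = d+α`,
   `w ≠ 0` (`torusCoupling_algebraic_eq_integral`): `|v|₁^{-s} = Γ(s)^{-1}∫t^{s-1}e^{-t|v|₁}dt`
   (Mathlib's `Real.integral_rpow_mul_exp_neg_mul_Ioi`), `e^{-t|v|₁} = ∏ᵢe^{-t|vᵢ|}`, the sum over
   `z ∈ ℤ^d` of coordinate products is the product of the coordinate sums (`hasSum_pi_prod`), and the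
   exchange of `∑_z` with `∫dt` (`integral_tsum_of_summable_integral_norm`); the integrand is integrable
   by domination by Gamma integrands (`integrableOn_rpow_mul_prod_pexp`, `1/(1-e^{-x}) ≤ 1+1/x`);
3. **`torusCoupling_algebraic_reflectionPositive`**: for `N ≥ 2`, every direction `i`, mirror `c`
   and `u`, `∑_{x,y∈𝕋⁺}J^{(N)}_{x,Θy}u_xu_y ≥ 0` — at fixed `t` the crossing kernel factorises over
   coordinates into feature-represented kernels (the reflected coordinate contributes the rank-two
   kernel `e^te^{-ta}e^{-tb} + e^{-t(N+1)}e^{ta}e^{tb}`), and positive integrals of positive semidefinite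
   kernels are positive semidefinite; evenness and mirror invariance of `J^{(N)}`
   (`torusCoupling_algebraic_neg`, `convCoupling_torusCoupling_algebraic_reflect`);
4. the centred lattice momenta `θ_k ∈ (-π,π]^d` (`centeredMomentum`), `χ_k(ȳ) = e^{iθ_k·y}`
   (`torusChar_proj`), the identification of the `w`-state of `WeightedInfraredBound.lean` with the
   torus Gibbs state of `LongRangeTrivialityOnZ3Torus.lean` (`wExpect_eq_torusExpect`), and Remark 3.5 on
   the torus, `E_{J^{(N)}}(k) = |J|(1-Ĵ(θ_k))` (`couplingGap_torusCoupling`);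
5. **`torus_twoPointFourier_le`** — Proposition 3.4 for this family with the Fröhlich–Simon–Spencer
   constant: `∑_z⟨σ₀σ_z⟩_{𝕋_N,J^{(N)},β}Re χ_k(z) ≤ 1/(β|J|(1-Ĵ(θ_k)))` (`N` even, `N ≥ 4`, `β > 0`),
   and with the cube bound `1-Ĵ(q) ≥ c'‖q‖^{α∧2}` of `…InfraredBound.lean`, `≤ ‖θ_k‖^{-(α∧2)}/(β|J|c')`
   for `k ≠ 0` (`torus_twoPointFourier_le_rpow`).

## References

* R. Panis, arXiv:2309.05797 (2023) = Ann. Probab. 54 (2026), §3.1 (Definition 3.1, example (iii):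
  `J_{x,y} = C|x-y|₁^{-d-α}` is reflection positive; `J^{(L)}`), Proposition 3.4, Remark 3.5
  [Panis2023Triviality] (held; pp. 13–14 read).
* J. Fröhlich, R. Israel, E. H. Lieb, B. Simon, CMP 62 (1978) 1–34, §3 (reflection positivity of
  long-range pair interactions via Laplace transforms) [FILS1978] (not held; cited through Panis and
  Friedli–Velenik).
* S. Friedli, Y. Velenik, *Statistical Mechanics of Lattice Systems*, CUP (2017), Lemma 10.8,
  Thm. 10.24 [FriedliVelenik2017].
-/

noncomputable section

namespace Literature.Barriers.CriticalPhenomena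

open Literature.Probability.LatticeModels Literature.Probability.Percolation Filter Topology Finset
open _root_.MeasureTheory _root_.Set
open scoped symmDiff

namespace LongRangeIsing

/-! ### Positive semidefiniteness through features -/

section Features

variable {X M : Type*} [Fintype M]

/-- A kernel with a finite feature representation with nonnegative coefficients,
`K(x,y) = ∑_m c_m φ_m(x)φ_m(y)` (`c ≥ 0`) on `P`, is positive semidefinite on `P`:
`∑_{x,y∈P} K(x,y)u_xu_y = ∑_m c_m(∑_{x∈P}φ_m(x)u_x)² ≥ 0`. [folklore] -/
theorem sum_sum_mul_mul_nonneg_of_features (P : Finset X) (K : X → X → ℝ) (c : M → ℝ)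
    (φ : M → X → ℝ) (hc : ∀ m, 0 ≤ c m)
    (hK : ∀ x ∈ P, ∀ y ∈ P, K x y = ∑ m, c m * (φ m x * φ m y)) (u : X → ℝ) :
    0 ≤ ∑ x ∈ P, ∑ y ∈ P, K x y * u x * u y := by
  have h : ∑ x ∈ P, ∑ y ∈ P, K x y * u x * u y = ∑ m, c m * (∑ x ∈ P, φ m x * u x) ^ 2 := by
    have h1 : ∀ x ∈ P, ∀ y ∈ P, K x y * u x * u y = ∑ m, c m * (φ m x * u x) * (φ m y * u y) := by
      intro x hx y hy
      rw [hK x hx y hy, Finset.sum_mul, Finset.sum_mul]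
      exact Finset.sum_congr rfl fun m _ => by ring
    have h2 : ∀ m, c m * (∑ x ∈ P, φ m x * u x) ^ 2 = ∑ x ∈ P, ∑ y ∈ P, c m * (φ m x * u x) * (φ m y * u y) := by
      intro m
      rw [sq, Finset.sum_mul_sum, Finset.mul_sum]
      refine Finset.sum_congr rfl fun x _ => ?_
      rw [Finset.mul_sum]
      exact Finset.sum_congr rfl fun y _ => by ring
    calc ∑ x ∈ P, ∑ y ∈ P, K x y * u x * u y
        = ∑ x ∈ P, ∑ y ∈ P, ∑ m, c m * (φ m x * u x) * (φ m y * u y) :=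
          Finset.sum_congr rfl fun x hx => Finset.sum_congr rfl fun y hy => h1 x hx y hy
      _ = ∑ x ∈ P, ∑ m, ∑ y ∈ P, c m * (φ m x * u x) * (φ m y * u y) :=
          Finset.sum_congr rfl fun x _ => Finset.sum_comm
      _ = ∑ m, ∑ x ∈ P, ∑ y ∈ P, c m * (φ m x * u x) * (φ m y * u y) := Finset.sum_comm
      _ = ∑ m, c m * (∑ x ∈ P, φ m x * u x) ^ 2 := Finset.sum_congr rfl fun m _ => (h2 m).symm
  rw [h]
  exact Finset.sum_nonneg fun m _ => mul_nonneg (hc m) (sq_nonneg _)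

/-- The product of feature-represented kernels is feature-represented, with features indexed by
tuples: `∏ᵢ ∑_m cᵢ(m)φᵢ(m,x)φᵢ(m,y) = ∑_{m : ι → M} (∏ᵢcᵢ(mᵢ))(∏ᵢφᵢ(mᵢ,x))(∏ᵢφᵢ(mᵢ,y))`. [folklore] -/
theorem prod_sum_features {ι : Type*} [Fintype ι] [DecidableEq ι] (c : ι → M → ℝ) (φ : ι → M → X → ℝ)
    (x y : X) :
    ∏ i, ∑ m, c i m * (φ i m x * φ i m y) =
      ∑ m : ι → M, (∏ i, c i (m i)) * ((∏ i, φ i (m i) x) * ∏ i, φ i (m i) y) := by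
  rw [Finset.prod_univ_sum]
  rw [Fintype.piFinset_univ]
  refine Finset.sum_congr rfl fun m _ => ?_
  rw [Finset.prod_mul_distrib, Finset.prod_mul_distrib]

end Features

/-! ### The periodised exponential kernel on `ℤ/Nℤ` -/

section PeriodicExp

/-- `g_{N,t}(r) = (e^{-tr} + e^{-t(N-r)})/(1 - e^{-tN})`, the periodisation `∑_{n∈ℤ} e^{-t|r+Nn|}` of
`e^{-t|·|}` evaluated at a representative `r ∈ [0,N)` (`hasSum_exp_neg_mul_abs_periodic`). [folklore] -/
def pexp (N : ℕ) (t r : ℝ) : ℝ :=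
  (Real.exp (-(t * r)) + Real.exp (-(t * (N - r)))) / (1 - Real.exp (-(t * N)))

variable {N : ℕ} {t : ℝ}

/-- `1 - e^{-tN} > 0` for `tN > 0`. [folklore] -/
theorem one_sub_exp_neg_pos (h : 0 < t * N) : 0 < 1 - Real.exp (-(t * N)) := by
  have : Real.exp (-(t * N)) < 1 := Real.exp_lt_one_iff.2 (by linarith)
  linarith

/-- `g_{N,t} ≥ 0` for `t > 0`. [folklore] -/
theorem pexp_nonneg (ht : 0 < t) (hN : 0 < N) (r : ℝ) : 0 ≤ pexp N t r := by
  have h : 0 < t * N := mul_pos ht (by exact_mod_cast hN)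
  exact div_nonneg (add_nonneg (Real.exp_nonneg _) (Real.exp_nonneg _)) (one_sub_exp_neg_pos h).le

/-- `g_{N,t}(N - r) = g_{N,t}(r)`. [folklore] -/
theorem pexp_sub (N : ℕ) (t r : ℝ) : pexp N t (N - r) = pexp N t r := by
  unfold pexp
  rw [sub_sub_cancel, add_comm]

/-- **The periodisation of `e^{-t|·|}`**: for `t > 0` and an integer `0 ≤ r < N`,
`∑_{n∈ℤ} e^{-t|r + Nn|} = (e^{-tr} + e^{-t(N-r)})/(1 - e^{-tN})` (two geometric series). [folklore] -/
theorem hasSum_exp_neg_mul_abs_periodic (ht : 0 < t) {r : ℤ} (hr0 : 0 ≤ r) (hrN : r < N) :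
    HasSum (fun n : ℤ => Real.exp (-(t * |(r : ℝ) + N * n|))) (pexp N t r) := by
  have hN : (0 : ℝ) < N := by
    have : (0 : ℤ) < N := hr0.trans_lt hrN
    exact_mod_cast this
  set Q : ℝ := Real.exp (-(t * N)) with hQ
  have hQ0 : 0 ≤ Q := Real.exp_nonneg _
  have hQ1 : Q < 1 := Real.exp_lt_one_iff.2 (by nlinarith)
  have hgeom := hasSum_geometric_of_lt_one hQ0 hQ1
  have hr0' : (0 : ℝ) ≤ r := by exact_mod_cast hr0
  have hrN' : (r : ℝ) < N := by exact_mod_cast hrN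
  set f : ℤ → ℝ := fun n => Real.exp (-(t * |(r : ℝ) + N * n|)) with hf
  -- nonnegative `n`
  have h1 : HasSum (fun n : ℕ => f n) (Real.exp (-(t * r)) * (1 - Q)⁻¹) := by
    refine (hgeom.mul_left (Real.exp (-(t * r)))).congr_fun fun n => ?_
    symm
    have hn0 : (0 : ℝ) ≤ (r : ℝ) + N * ((n : ℤ) : ℝ) := by push_cast; positivity
    simp only [hf]
    rw [abs_of_nonneg hn0, hQ, ← Real.exp_nat_mul, ← Real.exp_add]
    congr 1
    push_cast
    ring
  -- negative `n = -(m+1)`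
  have h2 : HasSum (fun m : ℕ => f (-(m + 1))) (Real.exp (-(t * (N - r))) * (1 - Q)⁻¹) := by
    refine (hgeom.mul_left (Real.exp (-(t * (N - r))))).congr_fun fun m => ?_
    symm
    simp only [hf]
    push_cast
    have hle : (r : ℝ) + N * (-((m : ℝ) + 1)) ≤ 0 := by
      have hm0 : (0 : ℝ) ≤ N * (m : ℝ) := by positivity
      nlinarith
    rw [abs_of_nonpos hle, hQ, ← Real.exp_nat_mul, ← Real.exp_add]
    congr 1
    ring
  have h := HasSum.of_nat_of_neg_add_one h1 h2
  have hval : pexp N t r = Real.exp (-(t * r)) * (1 - Q)⁻¹ + Real.exp (-(t * (N - r))) * (1 - Q)⁻¹ := by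
    rw [pexp, ← hQ, div_eq_mul_inv, add_mul]
  rw [hval]
  exact h


/-! #### Sums over `ℤ/Nℤ` through representatives -/

/-- `∑_{m ∈ ℤ/Nℤ} H(val m) = ∑_{v<N} H(v)`. [folklore] -/
theorem sum_zmod_val_eq_sum_range [NeZero N] {β : Type*} [AddCommMonoid β] (H : ℕ → β) :
    ∑ m : ZMod N, H m.val = ∑ v ∈ Finset.range N, H v := by
  refine Finset.sum_nbij (fun m : ZMod N => m.val) (fun m _ => Finset.mem_range.2 (ZMod.val_lt m))
    (fun m _ m' _ h => ZMod.val_injective N h) (fun v hv => ?_) (fun _ _ => rfl)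
  rw [Finset.coe_range, Set.mem_Iio] at hv
  exact ⟨(v : ZMod N), Finset.mem_coe.2 (Finset.mem_univ _), ZMod.val_cast_of_lt hv⟩

/-- **The feature factorisation of the periodised exponential kernel**: for `t > 0` and
`a, b ∈ ℤ/Nℤ`, with `r = val(a - b)`,
`∑_{m∈ℤ/Nℤ} e^{-t·val(a-m)} e^{-t·val(b-m)} = (1 - e^{-tN})/(1 - e^{-2t}) · (e^{-tr} + e^{-t(N-r)})`,
i.e. the translation-invariant kernel `g_{N,t}(val(a-b))` on `ℤ/Nℤ` is a positive combination of the
`N` rank-one kernels `φ_m(a)φ_m(b)`, `φ_m(a) = e^{-t·val(a-m)}` — whence positive semidefinite. [folklore] -/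
theorem sum_exp_val_sub_mul_exp_val_sub [NeZero N] (ht : 0 < t) (a b : ZMod N) :
    ∑ m : ZMod N, Real.exp (-(t * (a - m).val)) * Real.exp (-(t * (b - m).val)) =
      (1 - Real.exp (-(t * N))) / (1 - Real.exp (-(2 * t))) *
        (Real.exp (-(t * (a - b).val)) + Real.exp (-(t * (N - (a - b).val)))) := by
  set r : ℕ := (a - b).val with hr
  have hrN : r < N := ZMod.val_lt _
  set p : ℝ := Real.exp (-(2 * t)) with hp
  set Q : ℝ := Real.exp (-(t * N)) with hQ
  have hp1 : p < 1 := Real.exp_lt_one_iff.2 (by linarith)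
  have hp1' : p - 1 ≠ 0 := by linarith
  -- reindex `m = b - m'`
  have h1 : ∑ m : ZMod N, Real.exp (-(t * (a - m).val)) * Real.exp (-(t * (b - m).val)) =
      ∑ m' : ZMod N, Real.exp (-(t * ((a - b) + m').val)) * Real.exp (-(t * m'.val)) := by
    refine (Fintype.sum_equiv (Equiv.subLeft b) _ _ fun m' => ?_).symm
    simp only [Equiv.subLeft_apply, sub_sub_cancel]
    rw [show a - (b - m') = a - b + m' by abel]
  -- pass to representatives
  have h2 : ∑ m' : ZMod N, Real.exp (-(t * ((a - b) + m').val)) * Real.exp (-(t * m'.val)) =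
      ∑ v ∈ Finset.range N, Real.exp (-(t * ((r + v) % N : ℕ))) * Real.exp (-(t * v)) := by
    rw [← sum_zmod_val_eq_sum_range (fun v => Real.exp (-(t * ((r + v) % N : ℕ))) * Real.exp (-(t * v)))]
    refine Finset.sum_congr rfl fun m' _ => ?_
    rw [ZMod.val_add]
  -- split the range at `N - r`
  have hsplit := Finset.sum_range_add_sum_Ico
    (fun v => Real.exp (-(t * ((r + v) % N : ℕ))) * Real.exp (-(t * v))) (Nat.sub_le N r)
  have h3 : ∑ v ∈ Finset.range (N - r), Real.exp (-(t * ((r + v) % N : ℕ))) * Real.exp (-(t * v)) =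
      Real.exp (-(t * r)) * ∑ v ∈ Finset.range (N - r), p ^ v := by
    rw [Finset.mul_sum]
    refine Finset.sum_congr rfl fun v hv => ?_
    rw [Finset.mem_range] at hv
    rw [Nat.mod_eq_of_lt (by omega), hp, ← Real.exp_nat_mul, ← Real.exp_add, ← Real.exp_add]
    congr 1
    push_cast
    ring
  have h4 : ∑ v ∈ Finset.Ico (N - r) N, Real.exp (-(t * ((r + v) % N : ℕ))) * Real.exp (-(t * v)) =
      Real.exp (-(t * (N - r))) * ∑ u ∈ Finset.range r, p ^ u := by
    rw [Finset.sum_Ico_eq_sum_range, show N - (N - r) = r by omega, Finset.mul_sum]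
    refine Finset.sum_congr rfl fun u hu => ?_
    rw [Finset.mem_range] at hu
    have hmod : (r + (N - r + u)) % N = u := by
      rw [show r + (N - r + u) = N + u by omega, Nat.add_mod_left, Nat.mod_eq_of_lt (by omega)]
    rw [hmod, hp, ← Real.exp_nat_mul, ← Real.exp_add, ← Real.exp_add]
    congr 1
    push_cast
    rw [Nat.cast_sub hrN.le]
    ring
  -- the two exponential identities `e^{-tr}p^{N-r} = Qe^{-t(N-r)}`, `e^{-t(N-r)}p^r = Qe^{-tr}`
  have e1 : Real.exp (-(t * r)) * p ^ (N - r) = Q * Real.exp (-(t * (N - r))) := by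
    rw [hp, hQ, ← Real.exp_nat_mul, ← Real.exp_add, ← Real.exp_add]
    congr 1
    rw [Nat.cast_sub hrN.le]
    ring
  have e2 : Real.exp (-(t * (N - r))) * p ^ r = Q * Real.exp (-(t * r)) := by
    rw [hp, hQ, ← Real.exp_nat_mul, ← Real.exp_add, ← Real.exp_add]
    congr 1
    ring
  rw [h1, h2, ← hsplit, h3, h4, geom_sum_eq hp1.ne (N - r), geom_sum_eq hp1.ne r]
  rw [show (1 - p) = -(p - 1) by ring]
  field_simp
  linear_combination e1 + e2

end PeriodicExp

/-! ### Products of series over `ℤ^d` -/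

section PiProd

/-- **A series over `ℤ^d` of products of coordinate factors is the product of the coordinate series**
(nonnegative terms): `∑_{z∈ℤ^d} ∏ᵢ fᵢ(zᵢ) = ∏ᵢ ∑_{n∈ℤ} fᵢ(n)`. [folklore] -/
theorem hasSum_pi_prod {d : ℕ} (f : Fin d → ℤ → ℝ) (hf0 : ∀ i n, 0 ≤ f i n) (a : Fin d → ℝ)
    (h : ∀ i, HasSum (f i) (a i)) :
    HasSum (fun z : Fin d → ℤ => ∏ i, f i (z i)) (∏ i, a i) := by
  induction d with
  | zero =>
      have h1 : (fun z : Fin 0 → ℤ => ∏ i, f i (z i)) = fun _ => 1 := by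
        funext z
        simp
      rw [h1, Finset.univ_eq_empty, Finset.prod_empty]
      have h2 := hasSum_fintype (fun _ : Fin 0 → ℤ => (1 : ℝ))
      simp only [Finset.univ_unique, Finset.sum_const, Finset.card_singleton, one_smul] at h2
      exact h2
  | succ d ih =>
      have ih' := ih (fun i : Fin d => f i.succ) (fun i n => hf0 _ _) (fun i : Fin d => a i.succ) (fun i => h i.succ)
      have h0 := h 0
      have hn0 : Summable fun n => ‖f 0 n‖ :=
        h0.summable.abs.congr fun n => (Real.norm_eq_abs _).symm
      set g : (Fin d → ℤ) → ℝ := fun z => ∏ i : Fin d, f i.succ (z i) with hg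
      have ih'' : HasSum g (∏ i : Fin d, a i.succ) := ih'
      have hn1 : Summable fun z : Fin d → ℤ => ‖g z‖ :=
        ih''.summable.abs.congr fun z => (Real.norm_eq_abs _).symm
      have hmul : HasSum (fun p : ℤ × (Fin d → ℤ) => f 0 p.1 * g p.2) (a 0 * ∏ i : Fin d, a i.succ) :=
        HasSum.mul (f := f 0) (g := g) h0 ih'' (summable_mul_of_summable_norm (f := f 0) (g := g) hn0 hn1)
      rw [Fin.prod_univ_succ]
      refine ((Fin.consEquiv (fun _ : Fin (d + 1) => ℤ)).hasSum_iff).1 ?_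
      convert hmul using 1
      funext p
      simp only [Function.comp_apply, Fin.consEquiv_apply, hg]
      rw [Fin.prod_univ_succ]
      simp only [Fin.cons_zero, Fin.cons_succ]

end PiProd

/-! ### The Laplace representation of the periodised power-law coupling -/

section Laplace

variable {d : ℕ}

/-- `e^{-t|v|₁} = ∏ᵢ e^{-t|vᵢ|}`. [folklore] -/
theorem exp_neg_mul_l1Norm (t : ℝ) (v : Site d) :
    Real.exp (-(t * l1Norm v)) = ∏ i, Real.exp (-(t * |(v i : ℝ)|)) := by
  rw [← Real.exp_sum]
  congr 1
  rw [l1Norm]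
  push_cast
  rw [Finset.mul_sum, ← Finset.sum_neg_distrib]
  refine Finset.sum_congr rfl fun i _ => ?_
  rw [Nat.cast_natAbs, Int.cast_abs]

/-- `|v|₁ ≥ 1` for `v ≠ 0`. [folklore] -/
theorem one_le_cast_l1Norm {v : Site d} (hv : v ≠ 0) : (1 : ℝ) ≤ l1Norm v := by
  have : l1Norm v ≠ 0 := fun h => hv (l1Norm_eq_zero_iff.1 h)
  exact_mod_cast Nat.one_le_iff_ne_zero.2 this

variable {N : ℕ}

/-- `0̃ = 0`. [folklore] -/
@[simp] theorem torusLift_zero [NeZero N] : torusLift N (0 : TorusSite d N) = 0 := by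
  funext i
  simp [torusLift]

/-- The lifts of a nonzero torus site are nonzero: `w̃ + Nz ≠ 0` for `w ≠ 0`. [folklore] -/
theorem torusLift_add_smul_ne_zero [NeZero N] {w : TorusSite d N} (hw : w ≠ 0) (z : Site d) :
    torusLift N w + (N : ℤ) • z ≠ 0 := by
  intro h
  have h1 : Torus.proj N (torusLift N w) = Torus.proj N 0 :=
    (proj_eq_proj_iff N (torusLift N w) 0).2 ⟨z, h.symm⟩
  rw [proj_torusLift] at h1
  exact hw (by rw [h1]; funext i; simp [Torus.proj])

/-- **The periodisation of `e^{-t|·|₁}` over `Nℤ^d` factorises**: for `t > 0` and `w̃ ∈ [0,N)^d`,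
`∑_{z∈ℤ^d} e^{-t|w̃+Nz|₁} = ∏ᵢ g_{N,t}(w̃ᵢ)`. [folklore] -/
theorem hasSum_exp_neg_mul_l1Norm_add_smul {t : ℝ} (ht : 0 < t) {w : Site d}
    (hw : ∀ i, 0 ≤ w i ∧ w i < N) :
    HasSum (fun z : Site d => Real.exp (-(t * l1Norm (w + (N : ℤ) • z)))) (∏ i, pexp N t (w i)) := by
  have h := hasSum_pi_prod (fun i n => Real.exp (-(t * |(w i : ℝ) + N * n|))) (fun i n => Real.exp_nonneg _)
    (fun i => pexp N t (w i)) (fun i => hasSum_exp_neg_mul_abs_periodic ht (hw i).1 (hw i).2)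
  refine h.congr_fun fun z => ?_
  rw [exp_neg_mul_l1Norm]
  refine Finset.prod_congr rfl fun i _ => ?_
  simp only [Pi.add_apply, Pi.smul_apply, smul_eq_mul]
  push_cast
  ring_nf

variable {C₀ α : ℝ}

/-- `J^{(N)}_{0,w} = ∑_z J_{0,w̃+Nz}`. [cite: Panis2023Triviality, §3.1 (J^{(L)}_{x,y} := ∑_z J_{x,y+Lz})] -/
theorem torusCoupling_zero_left [NeZero N] (J : Site d → Site d → ℝ) (w : TorusSite d N) :
    torusCoupling J N 0 w = ∑' z : Site d, J 0 (torusLift N w + (N : ℤ) • z) := by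
  rw [torusCoupling, torusLift_zero]

/-- **Laplace representation of one term**: for `v ≠ 0`,
`C₀|v|₁^{-s} = (C₀/Γ(s)) ∫₀^∞ t^{s-1}e^{-t|v|₁}dt` (`s > 0`). [folklore] -/
theorem algebraicCoupling_zero_eq_integral {s : ℝ} (hs : s = (d : ℝ) + α) (hs0 : 0 < s) {v : Site d}
    (hv : v ≠ 0) :
    algebraicCoupling d C₀ α 0 v =
      C₀ / Real.Gamma s * ∫ t in Ioi (0 : ℝ), t ^ (s - 1) * Real.exp (-((l1Norm v : ℝ) * t)) := by
  have hm : (0 : ℝ) < l1Norm v := lt_of_lt_of_le one_pos (one_le_cast_l1Norm hv)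
  rw [Real.integral_rpow_mul_exp_neg_mul_Ioi hs0 hm, algebraicCoupling_zero_apply hv, ← hs]
  have hΓ : Real.Gamma s ≠ 0 := (Real.Gamma_pos_of_pos hs0).ne'
  rw [one_div, Real.inv_rpow hm.le, Real.rpow_neg hm.le]
  field_simp

/-- The Laplace integrand of one term is integrable on `(0,∞)` (its integral is `Γ(s)|v|₁^{-s} ≠ 0`). [folklore] -/
theorem integrableOn_rpow_mul_exp {s : ℝ} (hs0 : 0 < s) {m : ℝ} (hm : 0 < m) :
    IntegrableOn (fun t : ℝ => t ^ (s - 1) * Real.exp (-(m * t))) (Ioi 0) := by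
  refine Integrable.of_integral_ne_zero ?_
  rw [Real.integral_rpow_mul_exp_neg_mul_Ioi hs0 hm]
  exact mul_ne_zero (Real.rpow_pos_of_pos (by positivity) _).ne' (Real.Gamma_pos_of_pos hs0).ne'

/-- **The Laplace representation of the periodised power-law coupling**: for `J_{x,y} = C₀|x-y|₁^{-d-α}`
(`C₀, α > 0`, `d ≥ 1`) and a nonzero torus site `w ∈ 𝕋_N`,
`J^{(N)}_{0,w} = (C₀/Γ(s)) ∫₀^∞ t^{s-1} ∏ᵢ g_{N,t}(w̃ᵢ) dt`, `s = d + α`,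
`g_{N,t}(r) = ∑_{n∈ℤ}e^{-t|r+Nn|} = (e^{-tr}+e^{-t(N-r)})/(1-e^{-tN})` — the periodisation of the
Laplace representation `|v|₁^{-s} = Γ(s)^{-1}∫₀^∞t^{s-1}e^{-t|v|₁}dt` of Fröhlich–Israel–Lieb–Simon's
example of a reflection-positive long-range coupling. [cite: Panis2023Triviality, §3.1 (example (iii): J_{x,y} = C|x-y|₁^{-d-α} is reflection positive)] -/
theorem torusCoupling_algebraic_eq_integral (hd : 1 ≤ d) (hC₀ : 0 < C₀) (hα : 0 < α) [NeZero N]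
    {w : TorusSite d N} (hw : w ≠ 0) :
    torusCoupling (algebraicCoupling d C₀ α) N 0 w =
      C₀ / Real.Gamma ((d : ℝ) + α) *
        ∫ t in Ioi (0 : ℝ), t ^ ((d : ℝ) + α - 1) * ∏ i, pexp N t ((w i).val : ℝ) := by
  set s : ℝ := (d : ℝ) + α with hsdef
  have hs0 : 0 < s := by positivity
  set J := algebraicCoupling d C₀ α with hJ
  set w' : Site d := torusLift N w with hw'
  have hne : ∀ z : Site d, w' + (N : ℤ) • z ≠ 0 := torusLift_add_smul_ne_zero hw
  set m : Site d → ℝ := fun z => (l1Norm (w' + (N : ℤ) • z) : ℝ) with hmdef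
  have hm : ∀ z, 0 < m z := fun z => lt_of_lt_of_le one_pos (one_le_cast_l1Norm (hne z))
  set F : Site d → ℝ → ℝ := fun z t => t ^ (s - 1) * Real.exp (-(m z * t)) with hF
  -- termwise Laplace representation
  have hterm : ∀ z, J 0 (w' + (N : ℤ) • z) = C₀ / Real.Gamma s * ∫ t in Ioi (0 : ℝ), F z t := fun z =>
    algebraicCoupling_zero_eq_integral hsdef hs0 (hne z)
  -- summability of the integrals
  have hJs : Summable fun z : Site d => J 0 (w' + (N : ℤ) • z) :=
    summable_coupling_add_smul J N (algebraicCoupling_add C₀ α) (algebraicCoupling_zero_summable hd hC₀.le hα) 0 w'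
  have hΓ : 0 < Real.Gamma s := Real.Gamma_pos_of_pos hs0
  have hint : ∀ z, Integrable (F z) (volume.restrict (Ioi 0)) := fun z => integrableOn_rpow_mul_exp hs0 (hm z)
  have hnorm : ∀ z, ∫ t in Ioi (0 : ℝ), ‖F z t‖ = ∫ t in Ioi (0 : ℝ), F z t := by
    intro z
    refine setIntegral_congr_fun measurableSet_Ioi fun t ht => ?_
    rw [Real.norm_eq_abs, abs_of_nonneg]
    exact mul_nonneg (Real.rpow_nonneg (le_of_lt ht) _) (Real.exp_nonneg _)
  have hsum : Summable fun z => ∫ t in Ioi (0 : ℝ), ‖F z t‖ := by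
    simp_rw [hnorm]
    have : ∀ z, ∫ t in Ioi (0 : ℝ), F z t = Real.Gamma s / C₀ * J 0 (w' + (N : ℤ) • z) := by
      intro z
      rw [hterm z]
      field_simp
    simp_rw [this]
    exact hJs.mul_left _
  -- the pointwise periodisation on `(0,∞)`
  have hw'i : ∀ i, 0 ≤ w' i ∧ w' i < N := fun i => by
    have h := mem_halfOpenBox.1 (torusLift_mem_halfOpenBox N w) i
    exact h
  have hpt : ∀ t ∈ Ioi (0 : ℝ), ∑' z, F z t = t ^ (s - 1) * ∏ i, pexp N t ((w i).val : ℝ) := by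
    intro t ht
    simp only [hF]
    rw [tsum_mul_left]
    congr 1
    have h := (hasSum_exp_neg_mul_l1Norm_add_smul (N := N) ht hw'i).tsum_eq
    have e : ∀ z, Real.exp (-(m z * t)) = Real.exp (-(t * l1Norm (w' + (N : ℤ) • z))) := fun z => by
      rw [hmdef, mul_comm]
    simp_rw [e, h]
    rfl
  calc torusCoupling J N 0 w = ∑' z : Site d, J 0 (w' + (N : ℤ) • z) := torusCoupling_zero_left J w
    _ = ∑' z : Site d, C₀ / Real.Gamma s * ∫ t in Ioi (0 : ℝ), F z t := tsum_congr hterm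
    _ = C₀ / Real.Gamma s * ∑' z : Site d, ∫ t in Ioi (0 : ℝ), F z t := tsum_mul_left
    _ = C₀ / Real.Gamma s * ∫ t in Ioi (0 : ℝ), ∑' z : Site d, F z t := by
        rw [integral_tsum_of_summable_integral_norm hint hsum]
    _ = C₀ / Real.Gamma s * ∫ t in Ioi (0 : ℝ), t ^ (s - 1) * ∏ i, pexp N t ((w i).val : ℝ) := by
        rw [setIntegral_congr_fun measurableSet_Ioi hpt]

end Laplace

/-! ### Integrability of the periodised Laplace integrand (domination by Gamma integrands) -/

section Domination

variable {N : ℕ} {t : ℝ}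

/-- `1/(1 - e^{-x}) ≤ 1 + 1/x` for `x > 0` (from `1 + x ≤ eˣ`). [folklore] -/
private theorem one_div_one_sub_exp_neg_le {x : ℝ} (hx : 0 < x) : 1 / (1 - Real.exp (-x)) ≤ 1 + 1 / x := by
  have hpos : 0 < 1 - Real.exp (-x) := by
    have : Real.exp (-x) < 1 := Real.exp_lt_one_iff.2 (by linarith)
    linarith
  have key : Real.exp (-x) * (1 + x) ≤ 1 := by
    rw [Real.exp_neg, inv_mul_le_iff₀ (Real.exp_pos x)]
    linarith [Real.add_one_le_exp x]
  have k2 : Real.exp (-x) / x + Real.exp (-x) ≤ 1 / x := by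
    rw [div_add' _ _ _ hx.ne', div_le_div_iff_of_pos_right hx]
    linarith
  rw [div_le_iff₀ hpos]
  have e : (1 + 1 / x) * (1 - Real.exp (-x)) = 1 - Real.exp (-x) + 1 / x - Real.exp (-x) / x := by ring
  rw [e]
  linarith

/-- `g_{N,t}(r) ≤ 2/(1 - e^{-tN})` for `0 ≤ r ≤ N`, `t > 0`. [folklore] -/
theorem pexp_le_two_div (ht : 0 < t) (hN : 0 < N) {r : ℝ} (hr0 : 0 ≤ r) (hrN : r ≤ N) :
    pexp N t r ≤ 2 / (1 - Real.exp (-(t * N))) := by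
  have h := one_sub_exp_neg_pos (mul_pos ht (by exact_mod_cast hN : (0 : ℝ) < N))
  unfold pexp
  refine div_le_div_of_nonneg_right ?_ h.le
  have h1 : Real.exp (-(t * r)) ≤ 1 := Real.exp_le_one_iff.2 (by nlinarith)
  have h2 : Real.exp (-(t * (N - r))) ≤ 1 := Real.exp_le_one_iff.2 (by nlinarith)
  linarith

/-- `g_{N,t}(r) ≤ 2e^{-t}/(1 - e^{-tN})` for `1 ≤ r ≤ N - 1`, `t > 0`. [folklore] -/
theorem pexp_le_two_exp_div (ht : 0 < t) (hN : 0 < N) {r : ℝ} (hr1 : 1 ≤ r) (hrN : r ≤ N - 1) :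
    pexp N t r ≤ 2 * Real.exp (-t) / (1 - Real.exp (-(t * N))) := by
  have h := one_sub_exp_neg_pos (mul_pos ht (by exact_mod_cast hN : (0 : ℝ) < N))
  unfold pexp
  refine div_le_div_of_nonneg_right ?_ h.le
  have h1 : Real.exp (-(t * r)) ≤ Real.exp (-t) := Real.exp_le_exp.2 (by nlinarith)
  have h2 : Real.exp (-(t * (N - r))) ≤ Real.exp (-t) := Real.exp_le_exp.2 (by nlinarith)
  linarith

/-- `(1 ∨ x)^d ≤ 1 + x^d` for `x ≥ 0`. [folklore] -/
theorem max_one_pow_le {x : ℝ} (hx : 0 ≤ x) (d : ℕ) : (max 1 x) ^ d ≤ 1 + x ^ d := by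
  rcases le_total x 1 with h | h
  · rw [max_eq_left h, one_pow]
    linarith [pow_nonneg hx d]
  · rw [max_eq_right h]
    linarith

/-- `g_{N,t}` is continuous in `t` on `(0,∞)`. [folklore] -/
theorem continuousOn_pexp (hN : 0 < N) (r : ℝ) : ContinuousOn (fun t : ℝ => pexp N t r) (Ioi 0) := by
  unfold pexp
  refine ContinuousOn.div (by fun_prop) (by fun_prop) fun t ht => ?_
  exact (one_sub_exp_neg_pos (mul_pos ht (by exact_mod_cast hN : (0 : ℝ) < N))).ne'

variable {d : ℕ}

/-- **The periodised Laplace integrand is integrable**: for `d ≥ 1`, `s > d`, `N ≥ 1`, `rᵢ ∈ [0,N]`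
with one coordinate `r_{i₀} ∈ [1, N-1]`, `t ↦ t^{s-1}∏ᵢg_{N,t}(rᵢ)` is integrable on `(0,∞)`: it is
dominated by `4^d e^{-t}(t^{s-1} + t^{s-d-1})` (`1/(1-e^{-tN}) ≤ 1 + 1/t`), two Gamma integrands. [folklore] -/
theorem integrableOn_rpow_mul_prod_pexp (hd : 1 ≤ d) {s : ℝ} (hsd : (d : ℝ) < s) (hN : 1 ≤ N)
    {r : Fin d → ℝ} (hr : ∀ i, 0 ≤ r i ∧ r i ≤ N) {i₀ : Fin d} (hr1 : 1 ≤ r i₀) (hr2 : r i₀ ≤ N - 1) :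
    IntegrableOn (fun t : ℝ => t ^ (s - 1) * ∏ i, pexp N t (r i)) (Ioi 0) := by
  have hs0 : 0 < s := lt_of_le_of_lt (Nat.cast_nonneg d) hsd
  have hN0 : 0 < N := hN
  have hNr : (1 : ℝ) ≤ N := by exact_mod_cast hN
  set H : ℝ → ℝ := fun t => (4 : ℝ) ^ d * (Real.exp (-t) * t ^ (s - 1)) +
    (4 : ℝ) ^ d * (Real.exp (-t) * t ^ ((s - d) - 1)) with hH
  have hHint : IntegrableOn H (Ioi 0) :=
    ((Real.GammaIntegral_convergent hs0).const_mul _).add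
      ((Real.GammaIntegral_convergent (by linarith : 0 < s - d)).const_mul _)
  have hmeas : ContinuousOn (fun t : ℝ => t ^ (s - 1) * ∏ i, pexp N t (r i)) (Ioi 0) :=
    (continuousOn_id.rpow_const fun t ht => Or.inl (ne_of_gt ht)).mul
      (continuousOn_finsetProd _ fun i _ => continuousOn_pexp hN0 (r i))
  refine Integrable.mono' hHint (hmeas.aestronglyMeasurable measurableSet_Ioi) ?_
  refine (ae_restrict_iff' measurableSet_Ioi).2 (ae_of_all _ fun t (ht : 0 < t) => ?_)
  have hQ := one_sub_exp_neg_pos (mul_pos ht (by exact_mod_cast hN0 : (0 : ℝ) < N))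
  -- `B = 1 + 1/(tN)` dominates `1/(1 - e^{-tN})`
  set B : ℝ := 1 + 1 / (t * N) with hB
  have hB1 : 1 ≤ B := by
    have : 0 ≤ 1 / (t * N) := by positivity
    linarith
  have hinvB : 1 / (1 - Real.exp (-(t * N))) ≤ B := one_div_one_sub_exp_neg_le (by positivity)
  have hBt : B ≤ 1 + 1 / t := by
    have : 1 / (t * N) ≤ 1 / t := by
      rw [one_div_le_one_div (by positivity) ht]
      nlinarith
    simpa [hB] using this
  -- each factor `≤ 2B`, the distinguished one `≤ e^{-t} 2B`
  have hfac : ∀ i, pexp N t (r i) ≤ 2 * B := fun i => by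
    calc pexp N t (r i) ≤ 2 / (1 - Real.exp (-(t * N))) := pexp_le_two_div ht hN0 (hr i).1 (hr i).2
      _ = 2 * (1 / (1 - Real.exp (-(t * N)))) := by ring
      _ ≤ 2 * B := by gcongr
  have hfac0 : pexp N t (r i₀) ≤ Real.exp (-t) * (2 * B) := by
    calc pexp N t (r i₀) ≤ 2 * Real.exp (-t) / (1 - Real.exp (-(t * N))) := pexp_le_two_exp_div ht hN0 hr1 hr2
      _ = Real.exp (-t) * (2 * (1 / (1 - Real.exp (-(t * N))))) := by ring
      _ ≤ Real.exp (-t) * (2 * B) := by gcongr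
  have hnn : ∀ i, 0 ≤ pexp N t (r i) := fun i => pexp_nonneg ht hN0 _
  have hprod : ∏ i, pexp N t (r i) ≤ Real.exp (-t) * (2 * B) ^ d := by
    rw [← Finset.mul_prod_erase Finset.univ (fun i => pexp N t (r i)) (Finset.mem_univ i₀)]
    have h1 : ∏ i ∈ Finset.univ.erase i₀, pexp N t (r i) ≤ (2 * B) ^ (d - 1) := by
      calc ∏ i ∈ Finset.univ.erase i₀, pexp N t (r i) ≤ ∏ _i ∈ Finset.univ.erase i₀, (2 * B) :=
            Finset.prod_le_prod (fun i _ => hnn i) fun i _ => hfac i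
        _ = (2 * B) ^ (d - 1) := by
            rw [Finset.prod_const, Finset.card_erase_of_mem (Finset.mem_univ _), Finset.card_univ, Fintype.card_fin]
    have h0 : 0 ≤ ∏ i ∈ Finset.univ.erase i₀, pexp N t (r i) := Finset.prod_nonneg fun i _ => hnn i
    calc pexp N t (r i₀) * ∏ i ∈ Finset.univ.erase i₀, pexp N t (r i)
        ≤ (Real.exp (-t) * (2 * B)) * (2 * B) ^ (d - 1) :=
          mul_le_mul hfac0 h1 h0 (by positivity)
      _ = Real.exp (-t) * (2 * B) ^ d := by
          rw [mul_assoc, ← pow_succ', Nat.sub_add_cancel hd]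
  -- `(2B)^d ≤ 4^d (1 + t^{-d})`
  have hpow : (2 * B) ^ d ≤ (4 : ℝ) ^ d * (1 + (1 / t) ^ d) := by
    have h1 : 2 * B ≤ 4 * max 1 (1 / t) := by
      have := le_max_left (1 : ℝ) (1 / t)
      have := le_max_right (1 : ℝ) (1 / t)
      linarith
    calc (2 * B) ^ d ≤ (4 * max 1 (1 / t)) ^ d := pow_le_pow_left₀ (by positivity) h1 d
      _ = (4 : ℝ) ^ d * (max 1 (1 / t)) ^ d := mul_pow _ _ _
      _ ≤ (4 : ℝ) ^ d * (1 + (1 / t) ^ d) := by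
          gcongr
          exact max_one_pow_le (by positivity) d
  -- assemble
  have hts : 0 ≤ t ^ (s - 1) := Real.rpow_nonneg ht.le _
  have hF0 : 0 ≤ t ^ (s - 1) * ∏ i, pexp N t (r i) := mul_nonneg hts (Finset.prod_nonneg fun i _ => hnn i)
  rw [Real.norm_eq_abs, abs_of_nonneg hF0]
  have hpowt : t ^ (s - 1) * (1 / t) ^ d = t ^ ((s - d) - 1) := by
    rw [one_div, inv_pow, ← Real.rpow_natCast, ← Real.rpow_neg ht.le, ← Real.rpow_add ht]
    congr 1
    ring
  calc t ^ (s - 1) * ∏ i, pexp N t (r i) ≤ t ^ (s - 1) * (Real.exp (-t) * (2 * B) ^ d) :=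
        mul_le_mul_of_nonneg_left hprod hts
    _ ≤ t ^ (s - 1) * (Real.exp (-t) * ((4 : ℝ) ^ d * (1 + (1 / t) ^ d))) := by gcongr
    _ = H t := by
        simp only [hH]
        rw [← hpowt]
        ring

end Domination

/-! ### Reflection positivity of the periodised power-law coupling on the even torus -/

section ReflectionPositivity

variable {d N : ℕ} {C₀ α : ℝ}

/-- `g_{N,t}(val(-a)) = g_{N,t}(val a)` (`g_{N,t}(N-r) = g_{N,t}(r)`). [folklore] -/
theorem pexp_val_neg [NeZero N] (t : ℝ) (a : ZMod N) : pexp N t ((-a).val : ℝ) = pexp N t (a.val : ℝ) := by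
  rw [ZMod.neg_val]
  split_ifs with h
  · subst h
    simp
  · rw [Nat.cast_sub (ZMod.val_le a), pexp_sub]

/-- **`J^{(N)}` is even**: `J^{(N)}_{0,-w} = J^{(N)}_{0,w}` for `J_{x,y} = C₀|x-y|₁^{-d-α}`. [folklore] -/
theorem torusCoupling_algebraic_neg (hd : 1 ≤ d) (hC₀ : 0 < C₀) (hα : 0 < α) [NeZero N] (w : TorusSite d N) :
    torusCoupling (algebraicCoupling d C₀ α) N 0 (-w) = torusCoupling (algebraicCoupling d C₀ α) N 0 w := by
  by_cases hw : w = 0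
  · subst hw
    simp
  · rw [torusCoupling_algebraic_eq_integral hd hC₀ hα (neg_ne_zero.2 hw),
      torusCoupling_algebraic_eq_integral hd hC₀ hα hw]
    congr 1
    refine setIntegral_congr_fun measurableSet_Ioi fun t _ => ?_
    congr 1
    exact Finset.prod_congr rfl fun i _ => by rw [Pi.neg_apply, pexp_val_neg]

/-- **`J^{(N)}` is invariant under the reflection of one coordinate**:
`J^{(N)}_{0,(w₁,…,-wᵢ,…,w_d)} = J^{(N)}_{0,w}` (the `ℓ¹` norm is coordinatewise even). [folklore] -/
theorem torusCoupling_algebraic_update_neg (hd : 1 ≤ d) (hC₀ : 0 < C₀) (hα : 0 < α) [NeZero N] (i : Fin d)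
    (w : TorusSite d N) :
    torusCoupling (algebraicCoupling d C₀ α) N 0 (Function.update w i (-w i)) =
      torusCoupling (algebraicCoupling d C₀ α) N 0 w := by
  by_cases hw : w = 0
  · subst hw
    simp
  · have hw' : Function.update w i (-w i) ≠ 0 := by
      intro h
      apply hw
      funext j
      by_cases hj : j = i
      · subst hj
        have := congr_fun h j
        simpa using this
      · have := congr_fun h j
        simpa [hj] using this
    rw [torusCoupling_algebraic_eq_integral hd hC₀ hα hw', torusCoupling_algebraic_eq_integral hd hC₀ hα hw]
    congr 1
    refine setIntegral_congr_fun measurableSet_Ioi fun t _ => ?_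
    congr 1
    refine Finset.prod_congr rfl fun j _ => ?_
    by_cases hj : j = i
    · subst hj
      rw [Function.update_self, pexp_val_neg]
    · rw [Function.update_of_ne hj]

/-- **Invariance of `J^{(N)}` under the reflections between sites** (hypothesis `hJθ` of the torus
Gaussian domination `wGaussZ_le_wGaussZ_zero`): `J^{(N)}_{Θx,Θy} = J^{(N)}_{x,y}` for
`Θ = Θ_{i,c} : xᵢ ↦ 2c+1-xᵢ`. [cite: FriedliVelenik2017, Lemma 10.8] -/
theorem convCoupling_torusCoupling_algebraic_reflect (hd : 1 ≤ d) (hC₀ : 0 < C₀) (hα : 0 < α) [NeZero N]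
    (i : Fin d) (c : ZMod N) (x y : TorusSite d N) :
    convCoupling (torusCoupling (algebraicCoupling d C₀ α) N 0) (Torus.reflectBetweenSites i c x)
        (Torus.reflectBetweenSites i c y) =
      convCoupling (torusCoupling (algebraicCoupling d C₀ α) N 0) x y := by
  unfold convCoupling
  have h : Torus.reflectBetweenSites i c y - Torus.reflectBetweenSites i c x =
      Function.update (y - x) i (-(y - x) i) := by
    funext j
    by_cases hj : j = i
    · subst hj
      simp only [Torus.reflectBetweenSites_apply, Pi.sub_apply, Function.update_self]
      ring
    · simp [Torus.reflectBetweenSites_apply, hj]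
  rw [h, torusCoupling_algebraic_update_neg hd hC₀ hα]

/-- The coefficients of the feature representation of the crossing kernel at Laplace parameter `t`
(coordinate `i` reflected: two rank-one terms; other coordinates: the `N` translates `φ_m`). [folklore] -/
def rpCoeff (N : ℕ) (i : Fin d) (t : ℝ) (i' : Fin d) (m : ZMod N) : ℝ :=
  if i' = i then
    (if m = 0 then Real.exp t / (1 - Real.exp (-(t * N)))
      else if m = 1 then Real.exp (-(t * (N + 1))) / (1 - Real.exp (-(t * N))) else 0)
  else (1 - Real.exp (-(2 * t))) / (1 - Real.exp (-(t * N))) ^ 2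

/-- The features of the crossing kernel at Laplace parameter `t`: `e^{∓t·val(xᵢ-c)}` in the reflected
coordinate, `e^{-t·val(x_{i'}-m)}` in the others. [folklore] -/
def rpFeature (N : ℕ) (i : Fin d) (c : ZMod N) (t : ℝ) (i' : Fin d) (m : ZMod N) (x : TorusSite d N) : ℝ :=
  if i' = i then (if m = 0 then Real.exp (-(t * (x i - c).val)) else Real.exp (t * (x i - c).val))
  else Real.exp (-(t * (x i' - m).val))

/-- The feature coefficients are nonnegative (`t > 0`). [folklore] -/
theorem rpCoeff_nonneg {t : ℝ} (ht : 0 < t) (hN : 0 < N) (i i' : Fin d) (m : ZMod N) : 0 ≤ rpCoeff N i t i' m := by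
  have hQ := one_sub_exp_neg_pos (mul_pos ht (by exact_mod_cast hN : (0 : ℝ) < N))
  have hp : 0 < 1 - Real.exp (-(2 * t)) := by
    have : Real.exp (-(2 * t)) < 1 := Real.exp_lt_one_iff.2 (by linarith)
    linarith
  unfold rpCoeff
  split_ifs <;> positivity

/-- **Reflection positivity of the periodised power-law coupling** (hypothesis `hK` of the torus
Gaussian domination `wGaussZ_le_wGaussZ_zero` / `wInfraredBound`): for `J_{x,y} = C₀|x-y|₁^{-d-α}`
(`C₀, α > 0`, `d ≥ 1`), `N ≥ 2`, every coordinate direction `i`, mirror position `c` and test vector `u`,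
`∑_{x,y ∈ 𝕋⁺} J^{(N)}_{x,Θy} u_x u_y ≥ 0`, `𝕋⁺ = {1 ≤ val(xᵢ-c) ≤ N/2}`, `Θ = Θ_{i,c}`. Proof: by the
Laplace representation the crossing kernel is `(C₀/Γ(s))∫₀^∞t^{s-1}∏_{i'}g_{N,t}(val((Θy-x)_{i'}))dt`;
at fixed `t`, the reflected coordinate contributes `g_{N,t}(a+b-1) = [eᵗe^{-ta}e^{-tb} +
e^{-t(N+1)}e^{ta}e^{tb}]/(1-e^{-tN})` (`a = val(xᵢ-c)`, `b = val(yᵢ-c)`), each other coordinate the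
translation-invariant kernel `g_{N,t}(val(x_{i'}-y_{i'}))`, a positive combination of the rank-one kernels
`φ_m ⊗ φ_m` (`sum_exp_val_sub_mul_exp_val_sub`); products and positive integrals of such kernels are
positive semidefinite. This is Fröhlich–Israel–Lieb–Simon's reflection positivity of `|x-y|₁^{-s}`,
in the periodised form used by Panis. [cite: Panis2023Triviality, §3.1 (Definition 3.1 and example (iii): algebraically decaying interactions are reflection positive)] [cite: FriedliVelenik2017, Lemma 10.8] -/
theorem torusCoupling_algebraic_reflectionPositive (hd : 1 ≤ d) (hC₀ : 0 < C₀) (hα : 0 < α) (hN : 2 ≤ N)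
    (i : Fin d) (c : ZMod N) (u : TorusSite d N → ℝ) :
    haveI : NeZero N := ⟨by omega⟩
    0 ≤ ∑ x ∈ (Torus.halfBetweenSites i c).toFinset, ∑ y ∈ (Torus.halfBetweenSites i c).toFinset,
      convCoupling (torusCoupling (algebraicCoupling d C₀ α) N 0) x (Torus.reflectBetweenSites i c y) *
        u x * u y := by
  haveI : NeZero N := ⟨by omega⟩
  haveI : Fact (1 < N) := ⟨by omega⟩
  have hN0 : 0 < N := by omega
  have hN1 : 1 ≤ N := by omega
  have hNr : (2 : ℝ) ≤ N := by exact_mod_cast hN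
  set P := (Torus.halfBetweenSites (d := d) (L := N) i c).toFinset with hP
  set θ := Torus.reflectBetweenSites (d := d) (L := N) i c with hθ
  set J := algebraicCoupling d C₀ α with hJ
  set s : ℝ := (d : ℝ) + α with hs
  have hsd : (d : ℝ) < s := by rw [hs]; linarith
  have hΓ : 0 < Real.Gamma s := Real.Gamma_pos_of_pos (by positivity)
  -- membership in the positive half
  have hmem : ∀ x ∈ P, 1 ≤ (x i - c).val ∧ (x i - c).val ≤ N / 2 := fun x hx => by
    simpa [hP, Torus.halfBetweenSites] using hx
  have hhalf : 2 * (N / 2) ≤ N := Nat.mul_div_le N 2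
  -- the reflected difference
  have hdi : ∀ x y : TorusSite d N, (θ y - x) i = -((x i - c) + (y i - c) - 1) := fun x y => by
    simp only [hθ, Pi.sub_apply, Torus.reflectBetweenSites_apply, Function.update_self]
    ring
  have hdj : ∀ (x y : TorusSite d N) (j : Fin d), j ≠ i → (θ y - x) j = y j - x j := fun x y j hj => by
    simp [hθ, Torus.reflectBetweenSites_apply, hj]
  have hval : ∀ x ∈ P, ∀ y ∈ P, ((x i - c) + (y i - c) - 1).val = (x i - c).val + (y i - c).val - 1 := by
    intro x hx y hy
    obtain ⟨ha1, ha2⟩ := hmem x hx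
    obtain ⟨hb1, hb2⟩ := hmem y hy
    have h1 : ((y i - c) - 1).val = (y i - c).val - 1 := by
      rw [ZMod.val_sub (by rw [ZMod.val_one]; exact hb1), ZMod.val_one]
    rw [add_sub_assoc, ZMod.val_add_of_lt] <;> rw [h1] <;> omega
  have hval1 : ∀ x ∈ P, ∀ y ∈ P, 1 ≤ ((x i - c) + (y i - c) - 1).val ∧ ((x i - c) + (y i - c) - 1).val ≤ N - 1 := by
    intro x hx y hy
    rw [hval x hx y hy]
    have := hmem x hx; have := hmem y hy
    omega
  have hne : ∀ x ∈ P, ∀ y ∈ P, θ y - x ≠ 0 := by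
    intro x hx y hy h
    have h1 : (θ y - x) i = 0 := by rw [h]; rfl
    rw [hdi, neg_eq_zero] at h1
    have := (hval1 x hx y hy).1
    rw [h1, ZMod.val_zero] at this
    omega
  -- the distinguished coordinate of the reflected difference has representative in `[1, N-1]`
  have hvali : ∀ x ∈ P, ∀ y ∈ P, ((θ y - x) i).val = N - ((x i - c).val + (y i - c).val - 1) := by
    intro x hx y hy
    rw [hdi, ZMod.neg_val, if_neg, hval x hx y hy]
    intro h0
    have := (hval1 x hx y hy).1
    rw [h0, ZMod.val_zero] at this
    omega
  -- Laplace representation of the crossing kernel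
  have hK : ∀ x ∈ P, ∀ y ∈ P, convCoupling (torusCoupling J N 0) x (θ y) =
      C₀ / Real.Gamma s * ∫ t in Ioi (0 : ℝ), t ^ (s - 1) * ∏ i', pexp N t (((θ y - x) i').val : ℝ) :=
    fun x hx y hy => torusCoupling_algebraic_eq_integral hd hC₀ hα (hne x hx y hy)
  -- integrability of the crossing integrand
  have hInt : ∀ x ∈ P, ∀ y ∈ P,
      IntegrableOn (fun t : ℝ => t ^ (s - 1) * ∏ i', pexp N t (((θ y - x) i').val : ℝ)) (Ioi 0) := by
    intro x hx y hy
    refine integrableOn_rpow_mul_prod_pexp hd hsd hN1 (fun i' => ⟨Nat.cast_nonneg _, ?_⟩) (i₀ := i) ?_ ?_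
    · exact_mod_cast (ZMod.val_le _)
    · rw [hvali x hx y hy]
      have h4 := hval1 x hx y hy
      rw [hval x hx y hy] at h4
      have h2 : 1 ≤ N - ((x i - c).val + (y i - c).val - 1) := by omega
      exact_mod_cast h2
    · rw [hvali x hx y hy]
      have h4 := hval1 x hx y hy
      rw [hval x hx y hy] at h4
      have h5 : N - ((x i - c).val + (y i - c).val - 1) ≤ N - 1 := by omega
      have h6 : ((N - ((x i - c).val + (y i - c).val - 1) : ℕ) : ℝ) ≤ ((N - 1 : ℕ) : ℝ) := by exact_mod_cast h5
      rw [Nat.cast_sub hN1] at h6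
      simpa using h6
  -- the feature representation at a fixed Laplace parameter
  have hfeat : ∀ t : ℝ, 0 < t → ∀ x ∈ P, ∀ y ∈ P,
      ∏ i', pexp N t (((θ y - x) i').val : ℝ) =
        ∏ i', ∑ m : ZMod N, rpCoeff N i t i' m * (rpFeature N i c t i' m x * rpFeature N i c t i' m y) := by
    intro t ht x hx y hy
    have hQ := one_sub_exp_neg_pos (mul_pos ht (by positivity : (0 : ℝ) < N))
    have hp : 0 < 1 - Real.exp (-(2 * t)) := by
      have : Real.exp (-(2 * t)) < 1 := Real.exp_lt_one_iff.2 (by linarith)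
      linarith
    refine Finset.prod_congr rfl fun i' _ => ?_
    by_cases hi' : i' = i
    · subst hi'
      set a : ℕ := (x i' - c).val with ha
      set b : ℕ := (y i' - c).val with hb
      have hab := hval1 x hx y hy
      rw [hval x hx y hy] at hab
      -- left-hand side
      have hl : pexp N t (((θ y - x) i').val : ℝ) = pexp N t ((a + b - 1 : ℕ) : ℝ) := by
        rw [hdi, pexp_val_neg, hval x hx y hy]
      rw [hl]
      -- right-hand side: the two terms `m = 0, 1`
      have h01 : (0 : ZMod N) ≠ 1 := zero_ne_one
      rw [Finset.sum_eq_add (0 : ZMod N) 1 h01]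
      · simp only [rpCoeff, rpFeature, if_true, one_ne_zero, if_false]
        simp only [← ha, ← hb]
        rw [pexp, Nat.cast_sub (by omega : 1 ≤ a + b)]
        push_cast
        have e1 : Real.exp (-(t * ((a : ℝ) + b - 1))) = Real.exp t * (Real.exp (-(t * a)) * Real.exp (-(t * b))) := by
          rw [← Real.exp_add, ← Real.exp_add]; congr 1; ring
        have e2 : Real.exp (-(t * ((N : ℝ) - ((a : ℝ) + b - 1)))) =
            Real.exp (-(t * (N + 1))) * (Real.exp (t * a) * Real.exp (t * b)) := by
          rw [← Real.exp_add, ← Real.exp_add]; congr 1; ring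
        rw [e1, e2]
        field_simp
      · intro m _ hm
        simp only [rpCoeff, if_true, if_neg hm.1, if_neg hm.2, zero_mul]
      · intro h; exact absurd (Finset.mem_univ _) h
      · intro h; exact absurd (Finset.mem_univ _) h
    · -- a non-reflected coordinate: the translation-invariant periodised kernel
      have hl : pexp N t (((θ y - x) i').val : ℝ) = pexp N t ((x i' - y i').val : ℝ) := by
        rw [hdj x y i' hi', show y i' - x i' = -(x i' - y i') by ring, pexp_val_neg]
      rw [hl, pexp]
      simp only [rpCoeff, rpFeature, if_neg hi']
      rw [← Finset.mul_sum, sum_exp_val_sub_mul_exp_val_sub ht (x i') (y i')]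
      have hp' : 1 - Real.exp (-(t * 2)) ≠ 0 := by rw [mul_comm]; exact hp.ne'
      rw [div_mul_eq_mul_div, div_eq_div_iff hQ.ne' (by positivity)]
      field_simp
  -- positivity of the quadratic form at a fixed Laplace parameter
  have hpsd : ∀ t : ℝ, 0 < t →
      0 ≤ ∑ x ∈ P, ∑ y ∈ P, (∏ i', pexp N t (((θ y - x) i').val : ℝ)) * u x * u y := by
    intro t ht
    refine sum_sum_mul_mul_nonneg_of_features P _ (fun mm : Fin d → ZMod N => ∏ i', rpCoeff N i t i' (mm i'))
      (fun mm x => ∏ i', rpFeature N i c t i' (mm i') x)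
      (fun mm => Finset.prod_nonneg fun i' _ => rpCoeff_nonneg ht hN0 i i' (mm i')) (fun x hx y hy => ?_) u
    rw [hfeat t ht x hx y hy, prod_sum_features]
  -- exchange the finite sums with the Laplace integral
  set G : TorusSite d N → TorusSite d N → ℝ → ℝ :=
    fun x y t => t ^ (s - 1) * ∏ i', pexp N t (((θ y - x) i').val : ℝ) with hG
  have hsum : ∑ x ∈ P, ∑ y ∈ P, convCoupling (torusCoupling J N 0) x (θ y) * u x * u y =
      C₀ / Real.Gamma s * ∫ t in Ioi (0 : ℝ), ∑ x ∈ P, ∑ y ∈ P, G x y t * u x * u y := by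
    have hI : ∀ x ∈ P, ∀ y ∈ P, Integrable (fun t => G x y t * u x * u y) (volume.restrict (Ioi 0)) :=
      fun x hx y hy => ((hInt x hx y hy).mul_const (u x)).mul_const (u y)
    rw [integral_finsetSum _ fun x hx => integrable_finsetSum _ fun y hy => hI x hx y hy, Finset.mul_sum]
    refine Finset.sum_congr rfl fun x hx => ?_
    rw [integral_finsetSum _ fun y hy => hI x hx y hy, Finset.mul_sum]
    refine Finset.sum_congr rfl fun y hy => ?_
    rw [integral_mul_const, integral_mul_const, hK x hx y hy]
    ring
  rw [hsum]
  refine mul_nonneg (div_nonneg hC₀.le hΓ.le) (setIntegral_nonneg measurableSet_Ioi fun t ht => ?_)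
  have h1 : ∑ x ∈ P, ∑ y ∈ P, G x y t * u x * u y =
      t ^ (s - 1) * ∑ x ∈ P, ∑ y ∈ P, (∏ i', pexp N t (((θ y - x) i').val : ℝ)) * u x * u y := by
    rw [Finset.mul_sum]
    refine Finset.sum_congr rfl fun x _ => ?_
    rw [Finset.mul_sum]
    refine Finset.sum_congr rfl fun y _ => ?_
    simp only [hG]
    ring
  rw [h1]
  exact mul_nonneg (Real.rpow_nonneg (le_of_lt ht) _) (hpsd t ht)

end ReflectionPositivity

/-! ### Centred lattice momenta `θ_k ∈ (-π,π]^d` -/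

section Centered

variable {d N : ℕ}

/-- The centred representative of `a ∈ ℤ/Nℤ` in `(-N/2, N/2]`: `val a` if `2·val a ≤ N`, else `val a - N`. [folklore] -/
def centeredRep (N : ℕ) (a : ZMod N) : ℤ := if 2 * a.val ≤ N then (a.val : ℤ) else (a.val : ℤ) - N

/-- The centred lattice momentum `θ_k ∈ (-π,π]^d` of `k ∈ (ℤ/Nℤ)^d`: `θ_{k,i} = 2π·centeredRep(kᵢ)/N`
(the representative of `2πk/N` in the Brillouin zone). [cite: Panis2023Triviality, §3.3 (𝕋_L^* = (-π,π]^d ∩ (2π/L)ℤ^d)] -/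
def centeredMomentum (N : ℕ) (k : TorusSite d N) : Fin d → ℝ :=
  fun i => 2 * Real.pi * (centeredRep N (k i) : ℝ) / N

/-- The centred representative represents: `centeredRep(a) ≡ a (mod N)`. [folklore] -/
theorem intCast_centeredRep [NeZero N] (a : ZMod N) : ((centeredRep N a : ℤ) : ZMod N) = a := by
  unfold centeredRep
  split_ifs
  · simp
  · simp

/-- `2|centeredRep(a)| ≤ N`. [folklore] -/
theorem two_mul_abs_centeredRep_le [NeZero N] (a : ZMod N) : 2 * |centeredRep N a| ≤ N := by
  unfold centeredRep
  have hv := ZMod.val_lt a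
  split_ifs with h
  · rw [abs_of_nonneg (by positivity)]
    exact_mod_cast h
  · rw [abs_of_neg (by omega)]
    omega

/-- `centeredRep(a) = 0 ↔ a = 0`. [folklore] -/
theorem centeredRep_eq_zero_iff [NeZero N] (a : ZMod N) : centeredRep N a = 0 ↔ a = 0 := by
  constructor
  · intro h
    unfold centeredRep at h
    have hv := ZMod.val_lt a
    split_ifs at h with h2
    · exact (ZMod.val_eq_zero a).1 (by exact_mod_cast h)
    · omega
  · rintro rfl
    simp [centeredRep]

/-- `|centeredRep(a)| ≥ 1` for `a ≠ 0`. [folklore] -/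
theorem one_le_abs_centeredRep [NeZero N] {a : ZMod N} (ha : a ≠ 0) : 1 ≤ |centeredRep N a| := by
  have h : centeredRep N a ≠ 0 := fun h => ha ((centeredRep_eq_zero_iff a).1 h)
  exact Int.one_le_abs h

/-- `|θ_{k,i}| ≤ π`. [folklore] -/
theorem abs_centeredMomentum_le [NeZero N] (k : TorusSite d N) (i : Fin d) :
    |centeredMomentum N k i| ≤ Real.pi := by
  have hN : (0 : ℝ) < N := by exact_mod_cast Nat.pos_of_ne_zero (NeZero.ne N)
  have h := two_mul_abs_centeredRep_le (N := N) (k i)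
  have h' : 2 * |(centeredRep N (k i) : ℝ)| ≤ N := by exact_mod_cast h
  unfold centeredMomentum
  rw [abs_div, abs_of_pos hN, div_le_iff₀ hN, abs_mul, abs_of_pos Real.two_pi_pos]
  nlinarith [Real.pi_pos]

/-- `‖θ_k‖_∞ ≤ π`. [folklore] -/
theorem norm_centeredMomentum_le [NeZero N] (k : TorusSite d N) : ‖centeredMomentum N k‖ ≤ Real.pi :=
  (pi_norm_le_iff_of_nonneg Real.pi_pos.le).2 fun i => by
    rw [Real.norm_eq_abs]; exact abs_centeredMomentum_le k i

/-- A nonzero coordinate has `|θ_{k,i}| ≥ 2π/N`. [folklore] -/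
theorem le_abs_centeredMomentum [NeZero N] {k : TorusSite d N} {i : Fin d} (hk : k i ≠ 0) :
    2 * Real.pi / N ≤ |centeredMomentum N k i| := by
  have hN : (0 : ℝ) < N := by exact_mod_cast Nat.pos_of_ne_zero (NeZero.ne N)
  have h1 : (1 : ℝ) ≤ |(centeredRep N (k i) : ℝ)| := by exact_mod_cast one_le_abs_centeredRep hk
  unfold centeredMomentum
  rw [abs_div, abs_of_pos hN, abs_mul, abs_of_pos Real.two_pi_pos]
  exact div_le_div_of_nonneg_right (by nlinarith [Real.pi_pos]) hN.le

/-- `θ_{k,i} = 0 ↔ kᵢ = 0`. [folklore] -/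
theorem centeredMomentum_apply_eq_zero_iff [NeZero N] (k : TorusSite d N) (i : Fin d) :
    centeredMomentum N k i = 0 ↔ k i = 0 := by
  have hN : (N : ℝ) ≠ 0 := by exact_mod_cast NeZero.ne N
  unfold centeredMomentum
  rw [div_eq_zero_iff, or_iff_left hN, mul_eq_zero, or_iff_right Real.two_pi_pos.ne', Int.cast_eq_zero,
    centeredRep_eq_zero_iff]

/-- `‖θ_k‖_∞ ≥ 2π/N` for `k ≠ 0`. [folklore] -/
theorem le_norm_centeredMomentum [NeZero N] {k : TorusSite d N} (hk : k ≠ 0) :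
    2 * Real.pi / N ≤ ‖centeredMomentum N k‖ := by
  obtain ⟨i, hi⟩ : ∃ i, k i ≠ 0 := by
    by_contra h
    push Not at h
    exact hk (funext h)
  exact (le_abs_centeredMomentum hi).trans ((Real.norm_eq_abs _).symm.le.trans (norm_le_pi_norm _ i))

/-- `‖θ_k‖_∞ > 0` for `k ≠ 0`. [folklore] -/
theorem norm_centeredMomentum_pos [NeZero N] {k : TorusSite d N} (hk : k ≠ 0) : 0 < ‖centeredMomentum N k‖ := by
  have hN : (0 : ℝ) < N := by exact_mod_cast Nat.pos_of_ne_zero (NeZero.ne N)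
  exact lt_of_lt_of_le (by positivity) (le_norm_centeredMomentum hk)

/-- **Characters at lattice points**: `χ_k(ȳ) = e^{iθ_k·y}` for `y ∈ ℤ^d`. [cite: FriedliVelenik2017, §10.4] -/
theorem torusChar_proj [NeZero N] (k : TorusSite d N) (y : Site d) :
    torusChar k (Torus.proj N y) = Complex.exp (Complex.I * (phase (centeredMomentum N k) y : ℂ)) := by
  unfold torusChar
  have h : ∀ i, (ZMod.stdAddChar (k i * Torus.proj N y i) : ℂ) =
      Complex.exp (Complex.I * ((2 * Real.pi * (centeredRep N (k i) : ℝ) / N * (y i : ℝ) : ℝ) : ℂ)) := by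
    intro i
    have e : k i * Torus.proj N y i = ((centeredRep N (k i) * y i : ℤ) : ZMod N) := by
      rw [Int.cast_mul, intCast_centeredRep, Torus.proj_apply]
    rw [e, ZMod.stdAddChar_coe]
    congr 1
    push_cast
    ring
  simp_rw [h, ← Complex.exp_sum, ← Finset.mul_sum]
  congr 2
  rw [phase]
  push_cast
  refine Finset.sum_congr rfl fun i _ => ?_
  simp only [centeredMomentum]
  push_cast
  ring

/-- `cos(θ_k·(y + Nz)) = cos(θ_k·y)` (`Nθ_k ∈ 2πℤ^d`). [folklore] -/
theorem cos_phase_centeredMomentum_add_smul [NeZero N] (k : TorusSite d N) (y z : Site d) :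
    Real.cos (phase (centeredMomentum N k) (y + (N : ℤ) • z)) = Real.cos (phase (centeredMomentum N k) y) := by
  have hN : (N : ℝ) ≠ 0 := by exact_mod_cast NeZero.ne N
  have h : phase (centeredMomentum N k) (y + (N : ℤ) • z) =
      phase (centeredMomentum N k) y + ((∑ i, centeredRep N (k i) * z i : ℤ) : ℝ) * (2 * Real.pi) := by
    rw [phase_add, phase]
    congr 1
    push_cast
    rw [Finset.sum_mul]
    refine Finset.sum_congr rfl fun i _ => ?_
    simp only [centeredMomentum, Pi.smul_apply, smul_eq_mul, Int.cast_mul, Int.cast_natCast]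
    field_simp
  rw [h, Real.cos_add_int_mul_two_pi]

/-- `Re χ_k(z) = cos(θ_k·z̃)`. [cite: FriedliVelenik2017, §10.4] -/
theorem torusChar_re_eq_cos [NeZero N] (k z : TorusSite d N) :
    (torusChar k z).re = Real.cos (phase (centeredMomentum N k) (torusLift N z)) := by
  conv_lhs => rw [← proj_torusLift N z]
  rw [torusChar_proj, Complex.exp_re]
  simp only [Complex.mul_re, Complex.I_re, Complex.ofReal_re, zero_mul, Complex.I_im, Complex.ofReal_im,
    mul_zero, sub_zero, Real.exp_zero, one_mul, Complex.mul_im, one_mul, zero_add]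

end Centered

/-! ### The torus Gibbs state of `J^{(N)}` as the `w`-state; the Fourier symbol of `J^{(N)}` -/

section Bridge

variable {d N : ℕ}

/-- For translation-invariant `J`, `convCoupling (J^{(N)}_{0,·}) = J^{(N)}`. [folklore] -/
theorem convCoupling_torusCoupling (J : Site d → Site d → ℝ) (hJt : ∀ a x y, J (x + a) (y + a) = J x y)
    [NeZero N] : convCoupling (torusCoupling J N 0) = torusCoupling J N := by
  funext a b
  rw [convCoupling, torusCoupling_eq_zero_sub J N hJt a b]

variable {V : Type*} [Fintype V]

/-- `𝓔_c(σ,σ) = ∑∑c - ∑∑cσσ` for spins. [folklore] -/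
theorem wGradForm_spin_spin (c : V → V → ℝ) (σ : SpinConfig V) :
    wGradForm c (fun x => spinAt x σ) (fun x => spinAt x σ) =
      (∑ x, ∑ y, c x y) - ∑ x, ∑ y, c x y * spinAt x σ * spinAt y σ := by
  unfold wGradForm
  have h : ∀ x y, c x y * ((spinAt x σ - spinAt y σ) * (spinAt x σ - spinAt y σ)) =
      2 * c x y - 2 * (c x y * spinAt x σ * spinAt y σ) := by
    intro x y
    have hx := spinAt_mul_self x σ
    have hy := spinAt_mul_self y σ
    linear_combination c x y * hx + c x y * hy
  simp_rw [h, Finset.sum_sub_distrib, ← Finset.mul_sum]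
  ring

variable [NeZero N]

/-- **The `w`-weight is a constant multiple of the torus Boltzmann weight at zero field**:
`w_c(σ) = e^{-(β/2)∑∑c}·e^{-βH_{𝕋,c,0}(σ)}`. [folklore] -/
theorem wWeight_eq_mul_torusWeight (c : TorusSite d N → TorusSite d N → ℝ) (β : ℝ) (σ : SpinConfig (TorusSite d N)) :
    wWeight c β σ = Real.exp (-(β / 2) * ∑ x, ∑ y, c x y) * torusWeight c β 0 σ := by
  rw [wWeight, wGradForm_spin_spin, torusWeight, torusHamiltonian, ← Real.exp_add]
  congr 1
  simp only [zero_mul, sub_zero]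
  ring

/-- **The `w`-state is the torus Gibbs state at zero field.** [folklore] -/
theorem wExpect_eq_torusExpect (c : TorusSite d N → TorusSite d N → ℝ) (β : ℝ) (F : SpinConfig (TorusSite d N) → ℝ) :
    wExpect c β F = torusExpect c β 0 F := by
  unfold wExpect torusExpect torusPartition
  set K := Real.exp (-(β / 2) * ∑ x, ∑ y, c x y) with hKdef
  have hK : K ≠ 0 := (Real.exp_pos _).ne'
  have hnum : ∑ σ, wWeight c β σ * F σ = K * ∑ σ, F σ * torusWeight c β 0 σ := by
    rw [Finset.mul_sum]
    refine Finset.sum_congr rfl fun σ _ => ?_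
    rw [wWeight_eq_mul_torusWeight]
    ring
  have hden : ∑ σ, wWeight c β σ = K * ∑ σ, torusWeight c β 0 σ := by
    rw [Finset.mul_sum]
    refine Finset.sum_congr rfl fun σ _ => ?_
    rw [wWeight_eq_mul_torusWeight]
  rw [hnum, hden, mul_div_mul_left _ _ hK]

/-- **The torus two-point function of `J^{(N)}`** in the two presentations: `wTwoPoint = G_N`. [folklore] -/
theorem wTwoPoint_torusCoupling (J : Site d → Site d → ℝ) (hJt : ∀ a x y, J (x + a) (y + a) = J x y) (β : ℝ)
    (z : TorusSite d N) :
    wTwoPoint (convCoupling (torusCoupling J N 0)) β z =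
      torusExpect (torusCoupling J N) β 0 (fun σ => spinAt 0 σ * spinAt z σ) := by
  rw [wTwoPoint, convCoupling_torusCoupling J hJt, wExpect_eq_torusExpect]

/-- **The Fourier symbol of the periodised coupling is that of `J`** (Panis, Remark 3.5 on the torus):
`E_{J^{(N)}}(k) = ∑_{w∈𝕋_N}J^{(N)}_{0,w}(1 - cos θ_k·w̃) = ∑_{x∈ℤ^d}J_{0,x}(1 - cos θ_k·x) = |J|(1 - Ĵ(θ_k))`.
[cite: Panis2023Triviality, Remark 3.5 and Proposition 3.4 (|J|(1-Ĵ(p)))] -/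
theorem couplingGap_torusCoupling (J : Site d → Site d → ℝ) (hJ0 : ∀ x, 0 ≤ J 0 x)
    (hJt : ∀ a x y, J (x + a) (y + a) = J x y) (hJs : Summable (J 0)) (h0 : couplingNorm J ≠ 0)
    (k : TorusSite d N) :
    couplingGap (torusCoupling J N 0) k = couplingNorm J * (1 - couplingFourier J (centeredMomentum N k)) := by
  rw [one_sub_couplingFourier_eq J hJs h0, mul_div_cancel₀ _ h0, couplingGap]
  set θ := centeredMomentum N k with hθ
  set g : Site d → ℝ := fun x => (1 - Real.cos (phase θ x)) * J 0 x with hg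
  have hgs : Summable g := by
    refine Summable.of_nonneg_of_le (fun x => mul_nonneg (sub_nonneg.2 (Real.cos_le_one _)) (hJ0 x))
      (fun x => ?_) (hJs.mul_left 2)
    have := Real.neg_one_le_cos (phase θ x)
    simp only [hg]
    nlinarith [hJ0 x]
  set e := siteEquivTorusProd (d := d) N with he
  have hf : Summable fun p : TorusSite d N × Site d => g (e.symm p) := (e.symm.summable_iff).2 hgs
  have h1 : ∑' p : TorusSite d N × Site d, g (e.symm p) = ∑' x, g x := e.symm.tsum_eq g
  have hfib : ∀ w : TorusSite d N, Summable fun z : Site d => g (e.symm (w, z)) := by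
    intro w
    have hs := summable_coupling_add_smul J N hJt hJs 0 (torusLift N w)
    refine Summable.of_nonneg_of_le (fun z => mul_nonneg (sub_nonneg.2 (Real.cos_le_one _)) (hJ0 _))
      (fun z => ?_) (hs.mul_left 2)
    have := Real.neg_one_le_cos (phase θ (torusLift N w + (N : ℤ) • z))
    have h0' := hJ0 (torusLift N w + (N : ℤ) • z)
    show (1 - Real.cos (phase θ (torusLift N w + (N : ℤ) • z))) * J 0 (torusLift N w + (N : ℤ) • z) ≤ _
    nlinarith
  rw [← h1, hf.tsum_prod' hfib, tsum_fintype]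
  refine Finset.sum_congr rfl fun w _ => ?_
  have h2 : ∀ z : Site d, g (e.symm (w, z)) =
      (1 - (torusChar k w).re) * J 0 (torusLift N w + (N : ℤ) • z) := by
    intro z
    show (1 - Real.cos (phase θ (torusLift N w + (N : ℤ) • z))) * J 0 (torusLift N w + (N : ℤ) • z) = _
    rw [cos_phase_centeredMomentum_add_smul, torusChar_re_eq_cos]
  simp_rw [h2]
  rw [tsum_mul_left, torusCoupling_zero_left, mul_comm]

end Bridge

/-! ### The infrared bound on the even torus for `J_{x,y} = C₀|x-y|₁^{-d-α}` -/

section TorusInfrared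

variable {d N : ℕ} {C₀ α : ℝ}

/-- **The torus infrared bound for the periodised power-law coupling** (Panis's Proposition 3.4 for
`J_{x,y} = C₀|x-y|₁^{-d-α}`, with the Fröhlich–Simon–Spencer constant): on `𝕋_N`, `N` even, `N ≥ 4`,
`β > 0`, for every `k` with `Ĵ(θ_k) < 1`,
`Ŝ_N(k) := ∑_{z∈𝕋_N}⟨σ₀σ_z⟩_{𝕋_N,J^{(N)},β} cos(θ_k·z̃) ≤ 1/(β|J|(1 - Ĵ(θ_k)))` — Gaussian domination
(`wInfraredBound`) applied with the reflection positivity `torusCoupling_algebraic_reflectionPositive`.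
[cite: Panis2023Triviality, Proposition 3.4] [cite: FriedliVelenik2017, Thm. 10.24] -/
theorem torus_twoPointFourier_le (hd : 1 ≤ d) (hC₀ : 0 < C₀) (hα : 0 < α) [NeZero N] (hNe : Even N)
    (hN4 : 4 ≤ N) {β : ℝ} (hβ : 0 < β) {k : TorusSite d N}
    (hgap : 0 < 1 - couplingFourier (algebraicCoupling d C₀ α) (centeredMomentum N k)) :
    ∑ z, torusExpect (torusCoupling (algebraicCoupling d C₀ α) N) β 0 (fun σ => spinAt 0 σ * spinAt z σ) *
        (torusChar k z).re ≤
      1 / (β * (couplingNorm (algebraicCoupling d C₀ α) *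
        (1 - couplingFourier (algebraicCoupling d C₀ α) (centeredMomentum N k)))) := by
  set J := algebraicCoupling d C₀ α with hJ
  have hJt : ∀ a x y, J (x + a) (y + a) = J x y := algebraicCoupling_add C₀ α
  have hJ0 : ∀ x, 0 ≤ J 0 x := fun x => algebraicCoupling_nonneg hC₀.le α 0 x
  have hJs := algebraicCoupling_zero_summable hd hC₀.le hα
  have hpos := couplingNorm_algebraic_pos hd hC₀ hα
  have hgapE : 0 < couplingGap (torusCoupling J N 0) k := by
    rw [couplingGap_torusCoupling J hJ0 hJt hJs hpos.ne']
    exact mul_pos hpos hgap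
  have hN2 : 2 ≤ N := le_trans (by norm_num) hN4
  have hj0 : ∀ w, 0 ≤ torusCoupling J N 0 w := fun w =>
    torusCoupling_nonneg J N (algebraicCoupling_nonneg hC₀.le α) 0 w
  have hje : ∀ w, torusCoupling J N 0 (-w) = torusCoupling J N 0 w := fun w =>
    torusCoupling_algebraic_neg hd hC₀ hα w
  have hJθ : ∀ (i : Fin d) (c : ZMod N) (x y : TorusSite d N),
      convCoupling (torusCoupling J N 0) (Torus.reflectBetweenSites i c x) (Torus.reflectBetweenSites i c y) =
        convCoupling (torusCoupling J N 0) x y := fun i c x y =>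
    convCoupling_torusCoupling_algebraic_reflect hd hC₀ hα i c x y
  have hK : ∀ (i : Fin d) (c : ZMod N) (u : TorusSite d N → ℝ),
      0 ≤ ∑ x ∈ (Torus.halfBetweenSites i c).toFinset, ∑ y ∈ (Torus.halfBetweenSites i c).toFinset,
        convCoupling (torusCoupling J N 0) x (Torus.reflectBetweenSites i c y) * u x * u y := fun i c u =>
    torusCoupling_algebraic_reflectionPositive hd hC₀ hα hN2 i c u
  have h : ∑ z, wTwoPoint (convCoupling (torusCoupling J N 0)) β z * (torusChar k z).re ≤
      1 / (β * couplingGap (torusCoupling J N 0) k) :=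
    wInfraredBound (torusCoupling J N 0) hNe hN4 hβ hj0 hje hJθ hK k hgapE
  rw [couplingGap_torusCoupling J hJ0 hJt hJs hpos.ne'] at h
  refine le_trans (le_of_eq (Finset.sum_congr rfl fun z _ => ?_)) h
  rw [wTwoPoint_torusCoupling J hJt]

/-- The same bound through the cube lower bound `1 - Ĵ(q) ≥ c'‖q‖^{α∧2}`: for `k ≠ 0`,
`Ŝ_N(k) ≤ 1/(β|J|c'‖θ_k‖^{α∧2})`. [cite: Panis2023Triviality, Proposition 3.4 and §3.3 (1 - Ĵ(p) ≍ |p|^{α∧2})] -/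
theorem torus_twoPointFourier_le_rpow (hd : 1 ≤ d) (hC₀ : 0 < C₀) (hα : 0 < α) [NeZero N] (hNe : Even N)
    (hN4 : 4 ≤ N) {β : ℝ} (hβ : 0 < β) {c' : ℝ} (hc' : 0 < c')
    (hglob : ∀ q : Fin d → ℝ, ‖q‖ ≤ Real.pi →
      c' * ‖q‖ ^ min α 2 ≤ 1 - couplingFourier (algebraicCoupling d C₀ α) q)
    {k : TorusSite d N} (hk : k ≠ 0) :
    ∑ z, torusExpect (torusCoupling (algebraicCoupling d C₀ α) N) β 0 (fun σ => spinAt 0 σ * spinAt z σ) *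
        (torusChar k z).re ≤
      1 / (β * couplingNorm (algebraicCoupling d C₀ α) * c') * ‖centeredMomentum N k‖ ^ (-(min α 2)) := by
  have hpos := couplingNorm_algebraic_pos hd hC₀ hα
  have hθ := norm_centeredMomentum_pos hk
  have hlow := hglob _ (norm_centeredMomentum_le k)
  have hD : 0 < c' * ‖centeredMomentum N k‖ ^ min α 2 := mul_pos hc' (Real.rpow_pos_of_pos hθ _)
  have hgap : 0 < 1 - couplingFourier (algebraicCoupling d C₀ α) (centeredMomentum N k) := hD.trans_le hlow
  refine (torus_twoPointFourier_le hd hC₀ hα hNe hN4 hβ hgap).trans ?_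
  rw [Real.rpow_neg hθ.le]
  calc 1 / (β * (couplingNorm (algebraicCoupling d C₀ α) * (1 - couplingFourier (algebraicCoupling d C₀ α) (centeredMomentum N k))))
      ≤ 1 / (β * (couplingNorm (algebraicCoupling d C₀ α) * (c' * ‖centeredMomentum N k‖ ^ min α 2))) := by
        gcongr
    _ = 1 / (β * couplingNorm (algebraicCoupling d C₀ α) * c') * (‖centeredMomentum N k‖ ^ min α 2)⁻¹ := by
        field_simp

end TorusInfrared

end LongRangeIsing

end Literature.Barriers.CriticalPhenomena
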